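import Literature.AlgebraicGeometry.AbelianSchemes.SerreTensorFrobeniusTwist
import Literature.AlgebraicGeometry.AbelianSchemes.DualIsogenyRelFrobenius
import Literature.AlgebraicGeometry.AbelianSchemes.AbelianSchemeHomDescentPolarized
import Literature.AlgebraicGeometry.AbelianSchemes.DualIsogenyQuasiInverse
import HarnessLib

/-!
# (ST-2F-λ) The polarisation `λ^{(q)}` of the Frobenius twist, read on the Serre tensor: `ψ_P^*(e^*λ^{(q)}) = q·λ`, uniquely

Topic `Literature/AlgebraicGeometry/AbelianSchemes`, namespace `Literature.AlgebraicGeometry.AbelianSchemes.AbelianSchemeOver` (THEOREMS ONLY; no definition, no named fact,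
no `sorry`, no `instance`, no notation).  Cell `hodgecm-mathlib`, F0/P6 «MOD», sequel to ★ (ST-2F) `SerreTensorFrobeniusTwist` for the σ2 = (β′) spine of `stub_HFROB`
(LEAD M-16b (3)); `--supports stmt-HodgeConjecture-24832`, count-neutral.  HC_CM is proved only modulo the 2 remaining named inputs (hLiu418, h413) until rung 0
closes; this file discharges none of them.

## Mathematics

`k` a field of exponential characteristic `p`, `q = pⁿ`, `A/k` an abelian variety with `𝒪`-action on `A₀ = (ofAbelianVariety A).toOver`, `D = (Â, 𝒫)` a dual pair of `A₀`
with the unit hypothesis, `D^{(q)}` the dual pair of `A^{(q)}` (★ (DF-1) `DualPair.frobeniusTwist`), `λ : A → Â` a homomorphism and `λ^{(q)} = λ ×_k Frobⁿ : A^{(q)} → Â^{(q)}`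
(★ `baseChangeHom`).  ★ (DF-2): `F ≫ λ^{(q)} ≫ F^∨ = λ ≫ [q]` (`F = F_{A/k,q}`, ★ `relFrobeniusHom`; §1 restates it over `Spec k` in that currency).  Let `C = A ⊗_𝒪 𝔟`
be the Serre tensor, `ψ_P : A → C` the ideal translation, `DC` any dual pair of `C` with the unit hypothesis, and `e : C ≅ A^{(q)}` a homomorphism with
`ψ_P ≫ e = F` (★ (ST-2F) (R1)).  §2: the transported polarisation `λ_C := e ≫ λ^{(q)} ≫ e^∨_{DC,D^{(q)}}` pulls back to `q·λ`:
`ψ_P ≫ λ_C ≫ ψ_P^∨_{D,DC} = λ ≫ [q]_{Â}` (★ `dualIsogenyOver_comp`: `e^∨ ≫ ψ_P^∨ = (ψ_P ≫ e)^∨ = F^∨`).  §3: conversely ANY homomorphism `λ_C : C → DC.hat`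
with `ψ_P ≫ λ_C ≫ ψ_P^∨ = λ ≫ [q]` equals `e ≫ λ^{(q)} ≫ e^∨` (★ (λ) `comp_lam_comp_dualIsogenyOver_eq_of_pullback_eq`: cancel the fppf cover `ψ_P` on the left and the
quasi-invertible `ψ_P^∨` on the right, ★ `dualIsogenyOver_serreTranslate_comp_eq_pow_id`).  So under the recognition `A ⊗_𝒪 𝔟 ≅ A^{(q)}` the polarisation
`λ^{(q)}` IS the unique polarisation of the Serre tensor whose pull-back along `ψ_P` is `q·λ` — the «`λ`» entry of the tuple identity (c3a).

## Contents

* §1 `relFrobeniusHom_comp_baseChangeHom_comp_dualIsogenyOver` (`F ≫ λ^{(q)} ≫ F^∨ = λ ≫ [q]` in `Over (Spec k)`, ★ (DF-2) retyped).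
* §2 `dualIsogenyOver_comp_dualIsogenyOver_serreTranslate_eq` (`e^∨ ≫ ψ_P^∨ = F^∨`),
  **`serreTranslate_comp_transport_comp_dualIsogenyOver_eq`** (`ψ_P ≫ (e ≫ λ^{(q)} ≫ e^∨) ≫ ψ_P^∨ = λ ≫ [q]`).
* §3 **`transport_eq_of_serreTranslate_pullback_eq`** (uniqueness: `ψ_P ≫ λ_C ≫ ψ_P^∨ = λ ≫ [q] ⇒ e ≫ λ^{(q)} ≫ e^∨ = λ_C`).

## References
* [MumfordAV1970] D. Mumford, *Abelian Varieties* (1970), §15 Thm. 1 (p. 143), §23 (p. 231).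
* [Shimura1998] G. Shimura, *Abelian Varieties with Complex Multiplication and Modular Functions* (1998), §13.1 proof of Thm. 1 (pp. 97–99).
* [RapoportSmithlingZhang2020Diagonal] M. Rapoport, B. Smithling, W. Zhang (2020), §4 (p. 20), (4.23).
* [Oda1969] T. Oda, Ann. Sci. ÉNS (4) 2 (1969), §1 Cor. 1.3.
* Tree: ★ `SerreTensorFrobeniusTwist` (ST-2F), ★ `DualIsogenyRelFrobenius` (DF-1∕DF-2), ★ `AbelianSchemeHomDescentPolarized` (λ), ★ `DualIsogenyQuasiInverse`,
  ★ `AbelianSchemeDualIsogenyComp`, ★ `SerreTensorIdealTranslationKernel` (A).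
-/

noncomputable section

universe u

open CategoryTheory CategoryTheory.Limits AlgebraicGeometry MonoidalCategory CartesianMonoidalCategory
open scoped MonObj

-- `Scheme.Modules` / `SheafOfModules` are not reducible (as in Mathlib's `AlgebraicGeometry/Modules/Sheaf.lean`).
set_option backward.isDefEq.respectTransparency false

namespace Literature.AlgebraicGeometry.AbelianSchemes

namespace AbelianSchemeOver

open Literature.AlgebraicGeometry.Motives Literature.AlgebraicGeometry.Motives.AbelianVariety

variable {k : Type u} [Field k] (p : ℕ) [ExpChar k p] (n : ℕ) (A : AbelianVariety k)
  (D : (AbelianScheme.ofAbelianVariety A).toOver.DualPair)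
  (hD : Nonempty ((Scheme.Modules.pullback (DualPair.unitHatSlice D)).obj D.P ≅ SheafOfModules.unit _))
  (lam : (AbelianScheme.ofAbelianVariety A).toOver.X ⟶ D.hat.X) [IsMonHom (relFrobeniusHom p n A)]

include hD

/-! ## §1 `F ≫ λ^{(q)} ≫ F^∨ = λ ≫ [q]` over `Spec k`, in the `relFrobeniusHom` currency -/

/-- **`F ≫ λ^{(q)} ≫ F^∨_{D,D^{(q)}} = λ ≫ [q]_{Â}`** as morphisms over `Spec k` (★ (DF-2) `relFrobenius_comp_baseChangeHom_comp_dualIsogeny`, retyped on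
`relFrobeniusHom p n A : A₀.X ⟶ A^{(q)}.X`; the instance `[IsMonHom (relFrobeniusHom p n A)]` is ★ `isMonHom_relFrobeniusHom`, supplied by `haveI`).
[cite: MumfordAV1970, §15 Thm. 1 (p. 143)] [cite: Oda1969, §1 Cor. 1.3] -/
theorem relFrobeniusHom_comp_baseChangeHom_comp_dualIsogenyOver :
    relFrobeniusHom p n A ≫ baseChangeHom (A := (AbelianScheme.ofAbelianVariety A).toOver) (B := D.hat) lam (frobSpec k p n) ≫
        DualPair.dualIsogenyOver (relFrobeniusHom p n A) D (D.frobeniusTwist p n A) =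
      lam ≫ D.hat.mulN (p ^ n) := by
  apply Over.OverMorphism.ext
  rw [Over.comp_left, Over.comp_left, DualPair.dualIsogenyOver_left, Over.comp_left]
  exact DualPair.relFrobenius_comp_baseChangeHom_comp_dualIsogeny p n A D hD lam

/-! ## §2 The transported polarisation pulls back to `q·λ` along `ψ_P` -/

variable {A} {O : Type*} [CommRing O] (act : (AbelianScheme.ofAbelianVariety A).toOver.RingAction O)
  [IsCommMonObj (AbelianScheme.ofAbelianVariety A).toOver.X]
  {m : ℕ} (E' : Matrix (Fin m) (Fin m) O) (hE' : E' * E' = E') (P : Matrix (Fin m) (Fin 1) O) (Q : Matrix (Fin 1) (Fin m) O) {N : ℕ}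
  [IsMonHom (serreTranslate act E' hE' P)]
  (DC : (serreTensor act E' hE').DualPair)
  (e : (serreTensor act E' hE').X ≅ (AbelianScheme.ofAbelianVariety (A.frobeniusTwist p n)).toOver.X) [IsMonHom e.hom]

omit hD in
/-- `e^∨_{DC,D^{(q)}} ≫ ψ_P^∨_{D,DC} = F^∨_{D,D^{(q)}}` when `ψ_P ≫ e = F` (★ `dualIsogenyOver_comp`, ★ `dualIsogenyOver_congr`). [cite: MumfordAV1970, §15 Thm. 1 (p. 143)] -/
theorem dualIsogenyOver_comp_dualIsogenyOver_serreTranslate_eq (he : serreTranslate act E' hE' P ≫ e.hom = relFrobeniusHom p n A) :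
    DualPair.dualIsogenyOver e.hom DC (D.frobeniusTwist p n A) ≫ DualPair.dualIsogenyOver (serreTranslate act E' hE' P) D DC =
      DualPair.dualIsogenyOver (relFrobeniusHom p n A) D (D.frobeniusTwist p n A) := by
  rw [← DualPair.dualIsogenyOver_comp (serreTranslate act E' hE' P) e.hom D DC (D.frobeniusTwist p n A)]
  exact DualPair.dualIsogenyOver_congr D (D.frobeniusTwist p n A) he

/-- **`ψ_P ≫ (e ≫ λ^{(q)} ≫ e^∨) ≫ ψ_P^∨ = λ ≫ [q]_{Â}`**: the polarisation `λ^{(q)}` of the twist, transported to the Serre tensor `A ⊗_𝒪 𝔟` along a recognition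
isomorphism `e` with `ψ_P ≫ e = F`, pulls back along `ψ_P` to `q·λ`. [cite: MumfordAV1970, §15 Thm. 1 (p. 143)] [cite: Shimura1998, §13.1 proof of Thm. 1 (pp. 97–99)]
[cite: RapoportSmithlingZhang2020Diagonal, §4 (p. 20)] -/
theorem serreTranslate_comp_transport_comp_dualIsogenyOver_eq (he : serreTranslate act E' hE' P ≫ e.hom = relFrobeniusHom p n A) :
    serreTranslate act E' hE' P ≫
        (e.hom ≫ baseChangeHom (A := (AbelianScheme.ofAbelianVariety A).toOver) (B := D.hat) lam (frobSpec k p n) ≫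
          DualPair.dualIsogenyOver e.hom DC (D.frobeniusTwist p n A)) ≫
        DualPair.dualIsogenyOver (serreTranslate act E' hE' P) D DC =
      lam ≫ D.hat.mulN (p ^ n) := by
  simp only [Category.assoc]
  rw [dualIsogenyOver_comp_dualIsogenyOver_serreTranslate_eq p n D act E' hE' P DC e he, ← Category.assoc, he]
  exact relFrobeniusHom_comp_baseChangeHom_comp_dualIsogenyOver p n A D hD lam

/-! ## §3 Uniqueness: the polarisation of `A ⊗_𝒪 𝔟` pulling back to `q·λ` IS `e ≫ λ^{(q)} ≫ e^∨` -/

variable (hDC : Nonempty ((Scheme.Modules.pullback (DualPair.unitHatSlice DC)).obj DC.P ≅ SheafOfModules.unit _))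

include hDC


/-- **UNIQUENESS**: if `λ_C : A ⊗_𝒪 𝔟 → DC.hat` is a homomorphism with `ψ_P ≫ λ_C ≫ ψ_P^∨_{D,DC} = λ ≫ [q]_{Â}`, then `e ≫ λ^{(q)} ≫ e^∨_{DC,D^{(q)}} = λ_C`
(★ (λ) polarised recognition: `ψ_P` is an fppf cover — ★ flat∕surjective∕finite from the quasi-inverse row `Q`, `N ≠ 0` — and `ψ_P^∨` has the quasi-inverse `(ψ′_Q)^∨`,
★ `dualIsogenyOver_serreTranslate_comp_eq_pow_id`; `λ` a homomorphism). [cite: MumfordAV1970, §23 (p. 231)] [cite: MumfordAV1970, §15 Thm. 1 (p. 143)]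
[cite: Shimura1998, §13.1 proof of Thm. 1 (pp. 97–99)] -/
theorem transport_eq_of_serreTranslate_pullback_eq [IsMonHom lam] (hN : N ≠ 0) (hP : E' * P = P) (hQ : Q * E' = Q)
    (hQP : Q * P = Matrix.scalar (Fin 1) (N : O)) (hPQ : P * Q = Matrix.scalar (Fin m) (N : O) * E')
    (he : serreTranslate act E' hE' P ≫ e.hom = relFrobeniusHom p n A)
    (lamC : (serreTensor act E' hE').X ⟶ DC.hat.X) [IsMonHom lamC]
    (hpull : serreTranslate act E' hE' P ≫ lamC ≫ DualPair.dualIsogenyOver (serreTranslate act E' hE' P) D DC = lam ≫ D.hat.mulN (p ^ n)) :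
    e.hom ≫ baseChangeHom (A := (AbelianScheme.ofAbelianVariety A).toOver) (B := D.hat) lam (frobSpec k p n) ≫
        DualPair.dualIsogenyOver e.hom DC (D.frobeniusTwist p n A) = lamC := by
  haveI := flat_serreTranslate_left act E' hE' P Q hN hP hQ hQP hPQ
  haveI := surjective_serreTranslate_left act E' hE' P Q hN hP hQ hQP hPQ
  haveI := quasiCompact_serreTranslate_left act E' hE' P Q hN hP hQ hQP hPQ
  haveI := isMonHom_serreTranslateInv act E' hE' Q
  haveI := isMonHom_baseChangeHom (A := (AbelianScheme.ofAbelianVariety A).toOver) (B := D.hat) lam (frobSpec k p n)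
  haveI := DualPair.isMonHom_dualIsogenyOver e.hom DC (D.frobeniusTwist p n A) (D.nonempty_unitHatSlice_frobeniusTwist_iso p n A hD) hDC
  refine comp_lam_comp_dualIsogenyOver_eq_of_pullback_eq (serreTranslate act E' hE' P) D (D.frobeniusTwist p n A) DC e
    (baseChangeHom (A := (AbelianScheme.ofAbelianVariety A).toOver) (B := D.hat) lam (frobSpec k p n)) lamC
    (DualPair.dualIsogenyOver (serreTranslateInv act E' hE' Q) DC D) hN
    (dualIsogenyOver_serreTranslate_comp_eq_pow_id act E' hE' P Q hP hQ hPQ D DC hDC) ?_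
  -- both pull-backs are `λ ≫ [q]`
  rw [hpull, Category.assoc, DualPair.dualIsogenyOver_comp (serreTranslate act E' hE' P) e.hom D DC (D.frobeniusTwist p n A)]
  simpa only [Category.assoc] using (serreTranslate_comp_transport_comp_dualIsogenyOver_eq p n D hD lam act E' hE' P DC e he).symm

end AbelianSchemeOver

end Literature.AlgebraicGeometry.AbelianSchemes

end
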